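import Mathlib
import HarnessLib
import HarnessLib.Audit
import Summits.HodgeConjecture.Statement
import Literature.AlgebraicGeometry.HodgeTheory.HodgeLocus
import Literature.AlgebraicGeometry.HodgeTheory.HodgeConjecture
import Literature.AlgebraicGeometry.Motives.AtypicalHodgeLocus
import Literature.AlgebraicGeometry.Motives.FamiliesVHS
import Literature.AlgebraicGeometry.Motives.PeriodRealizationClassical
import Literature.AlgebraicGeometry.Motives.HodgeTensor
import Literature.AlgebraicGeometry.Motives.HodgeTensorDualProofs
import Literature.AlgebraicGeometry.Motives.HodgeTensorDualOpposedProofs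
import Literature.AlgebraicGeometry.Motives.HodgeTensorProductProofs
import Literature.AlgebraicGeometry.Motives.HodgeTensorProofs
import Literature.AlgebraicGeometry.Motives.HodgeTensorHomSeparationProofs
import Literature.AlgebraicGeometry.Motives.HodgeTensorHomProofs
import Literature.AlgebraicGeometry.Motives.HodgeTensorPowerProofs
import Literature.AlgebraicGeometry.Motives.HodgeTensorPowerOpposedProofs
import Literature.AlgebraicGeometry.Motives.AndrePeriodConjecture
import Summits.HodgeConjecture.HodgeConjecture.Theorems.HolomorphicDefectHodgeModelsExist
import HarnessLib.Audit.Status.Attr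

/-!
Route: PeriodDeficiency

DORMANT since 2026-08-24T19:47:13Z (reconciler: no traction for 7 d (last activity item-evidence-added at 2026-08-17T18:41:11Z); parked, not closed — `ledger route dormant route-HodgeConjecture-PeriodDeficiency --off` to reactivate) — unstaffed, not closed; items shared with open routes are served there. `ledger route dormant <id> --off` reactivates.

# Route PeriodDeficiency — André's period exchange rate over ℚ̄(s) makes ℚ̄-generic points
Hodge-generic; HC ⇐ that ∧ HC(ℚ̄)

X = HGQ ∧ HCQ̄ ("it suffices to show"). HGQ (`QbarGenericIsHodgeGeneric`): for every smooth
projective family f₀ : 𝒳₀ → S₀ over a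
smooth irreducible ℚ̄-variety and every s ∈ S(ℂ), the Mumford–Tate group of Hⁱ(X_s) has maximal
dimension on the ℚ̄-Zariski
closure W of s — "a ℚ̄-generic point is Hodge-generic", the pointwise form of
Klingler–Otwinowska–Urbanik's Conj. 1.5(a)
(fields of definition of Hodge loci) in the geometric case, and a consequence of HC
(Voisin2007HodgeLoci p. 2). HCQ̄
(`HodgeConjectureQbar`): the Hodge conjecture for ℚ̄-definable varieties (the common target of the
ℚ̄-anchored routes). Card
realised: period-deficient-special-points (spine): its mechanism is the rank-2 crux
`DeficiencyBound` — CONDITIONAL on André's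
generalized period conjecture GPC_K over finitely generated K ⊂ ℂ (BakkerTsimerman2025 Conj. 1.2;
Andre2004 ch. 23; André's
appendix to Bertolin2002): δ_W(s) := dim Ď_{G_W} − dim Ď_{MT(s)} ≤ dim W = trdeg ℚ̄(s), i.e. a point
can be special relative to
its own ℚ̄-closure only as a typical intersection; with BKU Thm 2.3 (level ≥ 3 ⇒ no typical special
points) this proves HGQ at
every point of zero period dimension — exactly the isolated-point case Voisin/KOU/BKU declare out of
reach (crux `IsolatedHodgePointsQbar`).
Lean: `QbarGenericIsHodgeGeneric ∧ HodgeConjectureQbar`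

## Assembly
Pure logic, sorry-free in Sketch.lean and glue.lean: `closes h₁ h₂ h₃ h₄ h₅ := h₄ h₃ h₁ h₂ h₅` —
GenericityReduction applied to
ClassicalGeometricVHS, QbarGenericIsHodgeGeneric, HodgeConjectureQbar and HodgeModelsExist yields
`_root_.HodgeConjecture`. All the
mathematics sits in the two cruxes of X (4, 5) and in the known reduction (support); DeficiencyBound
(2) and IsolatedHodgePointsQbar (3)
are the mechanism and its refutable headline, the planned children of crux 4 (§ Two-layer plan). The
conditional input GPC_K enters only
through DeficiencyBound.

Rationale: WHY THIS LINE. Transplant from the Kontsevich–Zagier/periods summit, in André's INEQUALITY form over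
a transcendental field: GPC_K (trdeg_ℚ K(periods
of h(X_s)) ≥ dim G_mot, BakkerTsimerman2025 Conj. 1.2, Nori = André on pure motives by Arapura2013)
charges trdeg K = dim W for the
modulus but pays with the motivic group of X_s, which contains the GENERIC Mumford–Tate group G_W of
the ℚ̄-closure (André sandwich
G_W ⊆ G_And(X_s)⁰: spreading of motivated cycles + Andre1996Motifs §2.5, Thm 0.4 — no GenMot
hypothesis needed); the upper bound
is a dimension count in the motivated period torsor (BostCharles2014 §2): the K̄-closure of the
comparison point is irreducible and
maps into the flags compatible with all Hodge tensors at s, whose component through F_s is Ď_{MT(s)}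
(smooth point, tangent
𝔪𝔱(s)_ℂ/F⁰; Deligne1982HodgeCycles Prop. 3.4), whence trdeg ≤ dim W + dim G_And − δ and δ_W(s) ≤ dim
W. So specialness of s
relative to W costs flag-codimension that only the transcendence degree of s can pay: rank-two
attractors on ℚ̄ CY3 pencils with
Sp₄ monodromy (δ = 2 > 1, CandelasEtAl2019, arXiv:2009.12650 p. 6 "should certainly be algebraic")
and isolated Hodge points of
level ≥ 3 hypersurface families (δ ≥ f_{p+1} > dim moduli, card table) cannot be transcendental,
while CM points of the j-line
(δ = 1 = dim W) are correctly invisible. What prior routes do not do: PeriodsPolice uses the TORSOR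
form of GPC at ℚ̄-POINTS and
files the complex-points step QbarDescent without mechanism; FiniteTreeOfFlavours files
RigidImpliesQbar (hypersurfaces) without
mechanism; QbarEnvelope/AnchorTransport move classes, not moduli; GreenGriffithsKerr2012
VIII.A.6/VIII.A.8 get fields of definition
of isolated CM points from "Hodge ⇒ absolute Hodge", not from transcendence. Negatives index: empty
(checked 2026-08-15).

RANKED CRUXES. #2 DeficiencyBound (crux) — (card K1, sharpened; the GPC_K-conditional content of the
bridge) for the classical Betti–Hodge datum B, every σ : ℚ̄ → ℂ, every smooth projective family f₀ :
𝒳₀ → S₀ over a smooth irreducible quasi-compact ℚ̄-scheme, every degree i, geometric VHS datum D of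
Rⁱf_*ℚ and every s ∈ S(ℂ) with ℚ̄-Zariski closure W = ⋂{Z ⊇ {s} closed, Aut(ℂ/ℚ̄)-stable}: dim
Ď_{G_W} ≤ dim Ď_{MT(Hⁱ(X_s))} + dim W (genericPeriodDomainDim ≤ mtDomainDimAt + zariskiDimOnPoints;
only pointwise Hodge structures enter, pinned by B.IsClassical). Derivation from GPC_K in § Why this
line; expected sharpening dim W ↦ period dimension of W via the BBT Stein factorisation and KOU
Lemma 3.4. [difficulty: open-problem] (why it might fail: Unconditionally it is a new transcendence
statement (e.g. no transcendental rank-2 attractor on any ℚ̄ CY3 pencil with Sp₄ monodromy); one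
certified transcendental atypical special point of zero period dimension refutes it AND GPC_K; GPC_K
is open beyond 1-motives (HuberWustholz2022).) [BakkerTsimerman2025, Andre2004, Bertolin2002,
Andre1996Motifs, BostCharles2014, Arapura2013, Deligne1982HodgeCycles, BaldiKlinglerUllmo2024,
CandelasEtAl2019, arXiv:2009.12650]
#3 IsolatedHodgePointsQbar (crux) — (card headline, real carriers) for a smooth projective family f₀
: 𝒳₀ → S₀ over a smooth irreducible ℚ̄-scheme and a connected component C of the locus of Hodge
classes of f = f₀ ⊗_σ ℂ in degree 2p (HodgeLocus.lean: étalé topology of R²ᵖf_*ℂ, rational (p,p)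
fibre classes): if the corresponding component of the Hodge locus is a single point, C.base = {s},
then {s} is defined over ℚ̄, i.e. s ∈ S(ℚ̄). Corollary of HGQ (W := ℚ̄-closure of s would lie in
C.base) and, in the atypical regime, of DeficiencyBound + BKU Thm 2.3; =
FiniteTreeOfFlavours.RigidImpliesQbar freed from hypersurfaces; the case "Voisin's criterion does
not say anything about" (Voisin2007HodgeLoci p. 2), KOU Cor. 1.14's residue, BKU §2.1 "zero period
dimension". [deps: QbarGenericIsHodgeGeneric] [difficulty: XL] (why it might fail: Implied by HC
(relative Hilbert scheme, Voisin2007HodgeLoci p. 2) and by Hodge⇒absolute Hodge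
(GreenGriffithsKerr2012 VIII.A.6); known only for CM points of Shimura-type families; a rigid Hodge
class / rank-2 attractor at a transcendental modulus refutes it and HC together.)
[Voisin2007HodgeLoci, KlinglerOtwinowskaUrbanik2023, BaldiKlinglerUllmo2024, GreenGriffithsKerr2012,
CattaniDeligneKaplan1995JAMS, CandelasEtAl2019]
#4 QbarGenericIsHodgeGeneric (crux) — (HGQ, first conjunct of X) for the classical Betti–Hodge
datum, every smooth projective family f₀ : 𝒳₀ → S₀ over a smooth irreducible ℚ̄-scheme, every degree
i, geometric VHS datum D and every s ∈ S(ℂ): s is Hodge-generic (dim MT maximal,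
VHSData.IsHodgeGenericIn) in its ℚ̄-Zariski closure W. Equivalent in the honest model to "every
irreducible component of every (tensorial) Hodge locus of a ℚ̄-family is defined over ℚ̄" (KOU Conj.
1.5(a), geometric case); HC ⇒ HGQ. Layer-2 plan: DeficiencyBound + BKU Thm 2.3 settle zero period
dimension in level ≥ 3; KOU Thm 1.12 settles weakly non-factor positive period dimension; residues =
level ≤ 2 typical points (CM/Kuga–Satake engines) and weakly-factor subvarieties. [deps:
DeficiencyBound] [difficulty: open-problem] (why it might fail: Beyond GPC_K+BKU remain typical
special points of level ≤ 2 subfamilies not of abelian/K3 type and weakly-FACTOR special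
subvarieties of positive period dimension (KOU Thm 1.12 needs non-factor; Cor 1.14's descent leaves
geometry); false iff a Hodge locus of a ℚ̄-family is not over ℚ̄ (⇒ ¬HC).)
[KlinglerOtwinowskaUrbanik2023, BaldiKlinglerUllmo2024, Voisin2007HodgeLoci, Andre1996Motifs,
Deligne1982HodgeCycles, arXiv:1408.2488, Klingler2017AtypicalConjectures]
#5 HodgeConjectureQbar (crux) — (second conjunct of X) the Hodge conjecture
(HodgeTheory.HodgeConjectureFor on the real carriers) for every smooth projective complex variety of
the form X₀ ×_{ℚ̄,σ} ℂ — verbatim the antecedent of PeriodsPolice.QbarDescent, the conclusion of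
PeriodsPolice's sub-assembly (GPC_And ∧ CompactCommutantTrivial ∧ LefschetzB ∧ ClassicalBridge), and
the target of QbarEnvelope.HCOverNumberFields / FiniteTreeOfFlavours.RigidQbarClassesAlgebraic; not
attacked inside this route. [difficulty: open-problem] (why it might fail: HC over ℚ̄ is open in
every dimension ≥ 4 exactly like HC (Weil classes on ℚ̄-abelian fourfolds, level ≥ 3 hypersurfaces
over ℚ̄); transcendence of the modulus says nothing here; its only engines are
absolute-Hodge/motivated (Deligne, André) and PeriodsPolice's conditional chain.)
[Deligne1982HodgeCycles, Andre1996Motifs, Voisin2007HodgeLoci, CharlesSchnell2014Notes, Deligne2000]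
#9 HodgeModelsExist (support) — (shared item stmt-HodgeConjecture-2742, verbatim signature) every
smooth projective complex variety has a Hodge model (Serre GAGA §2 + de Rham + Hodge decomposition;
tree named fact nonempty_hodgeModel, discharge in progress in HodgeModelExistenceDischarge);
supplies the anti-vacuity conjunct of HodgeConjectureFor in `closes`. [difficulty: L]
[SerreGAGA1956, VoisinHodgeI2002, Deligne2000]
#9 ClassicalGeometricVHS (support) — CONSTRUCTION / infrastructure debt (as
PeriodsPolice.ClassicalBridge): there is a classical Betti–Hodge datum B
(BettiHodgeData.IsClassical: Hodge structures = Hodge decomposition of X^an, cycle classes supported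
on cycles, fundamental-class data), Deligne's tensor-filtration facts hold (HodgeTensorFacts), and
every smooth projective family over a smooth irreducible ℚ̄-scheme carries a geometric VHS datum for
B in every degree (Ehresmann + proper base change: Rⁱf_*ℚ with its fibrewise Hodge structures and a
flat polarisation), with finite-dimensional fibres. Known mathematics (Hodge decomposition, Deligne
Hodge II 1.1–1.2, Voisin II §3.1), formally large. [difficulty: XL] [VoisinHodgeI2002,
VoisinHodgeII2003, DeligneHodgeII1971, Deligne2000]
#9 GenericityReduction (support) — KNOWN MATHEMATICS (the shape of CharlesSchnell2014Notes Thm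
11.3.19 / Voisin2007HodgeLoci Prop. 1.2 proof): ClassicalGeometricVHS → HGQ → HCQ̄ →
HodgeModelsExist → HodgeConjecture. Proof: given X/ℂ smooth projective and a rational (p,p) class α,
spread X over its field of definition: X ≅ fibre at a ℚ̄-generic point s of f₀ ⊗ ℂ, f₀ smooth
projective over a smooth irreducible affine ℚ̄-variety S₀ (so W = S); HGQ at s (degree 2p, only the
pointwise Hodge structures of D are used, pinned by IsClassical) gives dim MT(s) ≥ dim MT(t) for all
t, hence MT(s) = G_S ⊇ H_S (André: connected monodromy inside the generic MT group, Andre1996Motifs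
/ BakkerTsimerman2025 Thm 2.6), so a finite-index subgroup of π₁(S(ℂ), s) fixes α; by Riemann
existence the finite étale cover S' → S is defined over ℚ̄; Deligne's global invariant cycle theorem
+ semisimplicity (DeligneHodgeII1971 4.1.1) give a Hodge class β on a smooth projective
compactification of 𝒳 ×_S S' (a ℚ̄-variety) restricting to α; HCQ̄ makes β algebraic; restriction to
the fibre and the iso X ≅ X_s preserve algebraic classes (Fulton §6, §19); the Hodge-model conjunct
is HodgeModelsExist. [difficulty: XL] [CharlesSchnell2014Notes, Voisin2007HodgeLoci,
DeligneHodgeII1971, Andre1996Motifs, BakkerTsimerman2025]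

TWO-LAYER PLAN. Foreseen glued splits (k ≤ 3, depth 1), nothing filed now: (a)
QbarGenericIsHodgeGeneric ⇐ ZeroPeriodDimension → PositivePeriodDimension →
QbarGenericIsHodgeGeneric, where ZeroPeriodDimension ("no s is a special point of zero period
dimension of its own ℚ̄-closure") is fed by
DeficiencyBound + BKU Thm 2.3 in level ≥ 3 and by CM/Kuga–Satake/Lefschetz-(1,1) engines in level ≤
2, and PositivePeriodDimension is KOU Thm
1.12 (weakly non-factor) + the weakly-factor residue; (b) IsolatedHodgePointsQbar ⇐
QbarGenericIsHodgeGeneric (glue provable: an isolated base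
{s} containing the ℚ̄-closure of s forces W = {s}); (c) DeficiencyBound ⇐ GPCK (informal item, to be
typed once `AndrePeriodConjectureOver`
lands) → AndreSandwich (G_W ⊆ G_And(X_s)⁰, provable from Andre1996Motifs §2.5 + Thm 0.4) →
TorsorFlagCount (dim of the K̄-closure of the
comparison point ≤ dim Ď_{MT(s)} + dim G_And − dim(G_And⁰·F_s); algebraic geometry of the motivated
period torsor, BostCharles2014 §2).

KILL CRITERIA. (i) A certified transcendental atypical special point of zero period dimension on a
ℚ̄-family — e.g. a rank-two attractor / 2+2 splitting
of a hypergeometric CY3 pencil (CandelasEtAl2019, AESZ 34) at a modulus provably not algebraic —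
refutes DeficiencyBound (close
`refuted:DeficiencyBound`; the witness also refutes GPC_K: hand it to
Summits/KontsevichZagierPeriods as negative knowledge) and refutes
IsolatedHodgePointsQbar, hence HodgeConjecture itself. (ii) QbarGenericIsHodgeGeneric or
HodgeConjectureQbar refuted ⇒ ¬HC outright (both are
consequences of HC). (iii) If "Hodge ⇒ absolute Hodge" (GGK VIII.A.2) or KOU Conj. 1.5(a) is proved
by other means, crux 4 closes `proved`
elsewhere and this line is superseded (close `superseded --by` that route); if
PeriodsPolice.QbarDescent is proved directly, X collapses to
HodgeConjectureQbar and the route is moot as a separate line. (iv) Refutations through exotic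
GeometricVHSData/BettiHodgeData satisfying
IsClassical are signature repairs (pin D to the étalé local system of HodgeLocus.lean), not kills.

NOT DECOMPOSED YET. The typed form of GPC_K (definition request `AndrePeriodConjectureOver`; the
tree's NoriInterface / MotivatedPeriodTorsor have only the k = ℚ̄
equality / torsor forms) and the informal item GPCK; the sharpening dim W ↦ period dimension (BBT
Stein factorisation + KOU Lemma 3.4 descent,
transport-dependent hence junk-prone over VHSData today); the LEVEL of a VHS and BKU Thm 2.3 / 2.6
as named facts (AtypicalHodgeLocus.lean lists
them as not yet vendored); the KOU auxiliary-VHS descent of Cor. 1.14 (is 𝕍' = (T𝕍)^{H_Y} motivic,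
so that GPC_K applies to its special
points?); the Nori = André comparison (Arapura2013) inside the lower bound; per-family inputs
(monodromy Zariski-dense, Beukers–Heckman) needed
only to EVALUATE δ in examples; the level ≤ 2 residue (CM theory, André's motivated Kuga–Satake) and
the weakly-factor residue of crux 4.

CHEAPEST FALSIFIER. The unbiased complex-analytic census of 2+2 splittings on the 14 hypergeometric
CY3 pencils and AESZ 34 (card job j002978 has the δ/d
tables only): solve Σ aᵢ ∫_{γᵢ} Ω(z) = 0, |aᵢ| ≤ 5, by certified Picard–Fuchs continuation, detect
rank-two lattices in H^{3,0} ⊕ H^{0,3},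
PSLQ the modulus against algebraic numbers of small height; every splitting point found so far (z =
−1/7, 33 ± 8√17 for AESZ 34,
CandelasEtAl2019) is algebraic, as DeficiencyBound predicts; ONE robustly transcendental one kills
the line (and GPC_K, and HC). Not run in this
planner seat (no certified PF-continuation preset); the literature check was run instead:
GreenGriffithsKerr2012 Ch. VIII (read pp. 230–236),
Lam–Tripathy arXiv:2009.12650 pp. 2–7 (transcendental attractors are rank ONE, not special), KOU
§3.5, BKU §2 — nothing contradicts.

NUMBERS. δ versus d (card job j002978, re-derived): CY3 pencil with Hodge numbers (1,h,h,1), G =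
GSp_{2h+2}: dim Ď = (h+1)(h+2)/2 + h, 2+2-compatible
flags 1 + h(h+1)/2, δ = 2h > h ≥ dim(moduli) ≥ dim W (h = 1: δ = 2 > 1); isolated Hodge point of a
(p,p)-class with G_W the full similitude
group: δ ≥ f_{p+1} = h^{2p,0} + … + h^{p+1,p−1}, sextic fourfolds 427 > 426 = dim moduli, quartic
sixfolds margin 1; CM point of the
j-line: δ = 1 = dim W (silent, as it must be); Hodge-generic points: δ = 0. Items at open: 9 typed
(4 crux, 3 support, 1 assembly + closes)
+ 1 informal crux (GPCK) + 1 definition request.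

DEFINITION REQUESTS. - `AndrePeriodConjectureOver` (topic Literature/AlgebraicGeometry/Motives, next
to MotivatedPeriodTorsor / NoriInterface): for a finitely
  generated subfield K ⊂ ℂ and X₀ smooth projective over K, trdeg_ℚ K(entries of the comparison
matrix H_dR(X₀/K) ⊗ ℂ ≅ H_B(X₀(ℂ),ℚ) ⊗ ℂ on
  all powers) ≥ dim of the motivated Galois group of X₀ ⊗ ℂ (André–Grothendieck GPC over K,
BakkerTsimerman2025 Conj. 1.2, Andre2004
  §23; inequality form). Needed to type the informal crux GPCK and to state DeficiencyBound as `GPCK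
→ …`.
- cite fact wanted: Andre1996Motifs §2.5 Scolie (motivated cycles are invariant under extension of
algebraically closed fields and their
  de Rham components are defined over k̄) and Thm 0.4 (G_And reductive, = fixator of motivated
tensors) — inputs of AndreSandwich.
- cite fact wanted: BaldiKlinglerUllmo2024 Thm 2.3 (level ≥ 3 ⇒ typical Hodge locus empty) over
AtypicalHodgeLocus.lean once `level` exists.

Novelty: Searches (2026-08-15): card's searches inherited (lit read + grep of arXiv:math/0605766, 2010.03359,
2011.10703, 2208.05182, 2009.12650;
galaxy "generalized period conjecture" (0), "conjecture des périodes" --star all (7, none on special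
points), "attractors are not algebraic" (0);
novelty audit r25 queries); this seat: `lit read` GreenGriffithsKerr2012 (held book, grep
Grothendieck|transcendence degree|field of
definition: 35 hits; read pp. 19–24, 230–236: VIII.A.6, VIII.A.8 found), arXiv:1711.09387 Klingler
2017 (§5, §7 bi-algebraic: no GPC_K),
arXiv:2107.08838 BKU §1.3–2.3 (Thm 2.3 verbatim), arXiv:2010.03359 §1.2–1.3, §3.5 (Cor 1.14 proof),
arXiv:2208.05182 pp. 3, 6 (Conj 1.2, Thm
2.6), arXiv:math/0605766 pp. 2–5 (Thm 1.5, Lemma 2.4); `lit search` ×3 and `lit frontier/bridges`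
unavailable (searchd rc 75, 17:55–18:40Z,
recorded in NOTES); `ledger negatives` (0); all 46 Theses headers of the sub read for overlap.
Nearest prior art found: GreenGriffithsKerr2012 VIII.A.6 (Hodge⇒AH ⇒ Φ⁻¹(NL) components over k̄,
"isolated CM varieties are defined over k̄")
and VIII.A.8 (GPC in flag form at ℚ̄-POINTS); BakkerTsimerman2025 (Conj. 1.2 stated; functional
analogue proved, arithmetic of points untouched);
KlinglerOtwinowskaUrbanik2023 Thm 1.12 / Cor 1.14 (positive period dimension; points residual);
route PeriodsPolice (torsor GPC at ℚ̄-points).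
Delta: nobody applies André's K-version of the period conjecture at a TRANSCENDENTAL modulus and
weighs the flag-codimension of its
specialn  [refs: math/0605766, 1711.09387, 2107.08838, 2010.03359, 2208.05182, GreenGriffithsKerr2012, BakkerTsimerman2025, KlinglerOtwinowskaUrbanik2023]

Barriers (technique_class: transcendence-count, period-torsor, fields-of-definition): - technique_class: transcendence-count, period-torsor, fields-of-definition
- Literature.Barriers.HodgeConjecture.CattaniDeligneKaplan1995_hodgeLocus_algebraicFor: used
positively (components algebraic, ℚ̄-closures and dimensions meaningful); its recorded open evasion
— the FIELD OF DEFINITION of the Hodge locus — is exactly crux 4 / crux 3.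
- Literature.Barriers.HodgeConjecture.Serre1964_conjugateVarieties_notHomeomorphic: no Betti class
and no variety is transported under Aut(ℂ); the comparison point stays put and only the dimension of
its K̄-Zariski closure is counted (F_dR is K-rational, Hodge tensors are ℚ-Betti); the barrier is
even used: X_s and X_{τs} are abstractly isomorphic schemes, so only a non-scheme-theoretic lever (a
transcendence count) can see which one is special.
- Literature.Barriers.HodgeConjecture.Charles2009_conjugateVarieties_cohomologyAlgebrasNotIso: same
evasion — no comparison of cohomology algebras of conjugates is made.
- Literature.Barriers.HodgeConjecture.hodgeClassesAreAbsoluteFor_abelianVariety: consistent —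
abelian-type (level 1) special points are typical (δ = dim W allowed), the mechanism claims nothing
there and the level ≤ 2 residue of crux 4 imports Deligne/André engines instead.
- Literature.Barriers.HodgeConjecture.Andre1996_hodgeClassesOnAbelianVarieties_motivated: used as an
engine for the level ≤ 2 residue, never contradicted.
- Literature.Barriers.HodgeConjecture.Weil1977_exceptionalHodgeClasses: not engaged by the mechanism
(Weil

Novelty grade: new-combination — Refuter grade (g44-6; lit searchd down rc75 this session — grade rests on reading arXiv:2208.05182 p.3 + the tree's Barrier/Literature files + the planner's documented searches). Mechanism stripped of vocabulary: 'an arithmetic transcendence lower bound (GPC over the field generated by the modulus)  (refuter refuter-refute-pool-g44-6, 2026-08-15T18:47:51Z; prior: BakkerTsimerman2025 arXiv:2208.05182 Conj 1.2 / Thm 1.1 (functional GPC = Ax–Schanuel side), BaldiKlinglerUllmo2024 Thm 2.3 (Ax–Schanuel ⇒ atypical loci of positive period dimension), GreenGriffithsKerr2012 VIII.A.6/VIII.A.8 (GPC flag form at ℚ̄-points; isolated CM points over k̄ via absolute Hodge), KlinglerOtwinowskaUrbanik2023 Conj 1.5(a), Cor 1.14, Voisin2007HodgeLoci Thm 0.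5)

History (route lifecycle, newest last):
- 2026-08-15T21:16:24Z · rev 6: restated Assembly (stmt-HodgeConjecture-11599) — route-repair (ground-failed, unit rground-HodgeConjecture-PeriodDeficienc-77b0e187): item Assembly (stmt-HodgeConjecture-11599) was flagged ground.trivial (`int (planner-rground-HodgeConjecture-PeriodDeficienc-77b0e187-0)
- 2026-08-16T02:19:04Z · AUTO-CRUX: 1 conjecture-grade item(s) promoted to crux (GPCK) — refuter vetting / tiering apply (operator:999:1362873)
- 2026-08-24T19:47:13Z · DORMANT — reconciler: no traction for 7 d (last activity item-evidence-added at 2026-08-17T18:41:11Z); parked, not closed — `ledger route dormant route-HodgeConjecture-Pe (operator:999:2849053)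

sub-problem: HodgeConjecture · status: dormant · opened planner-plancard-HodgeConjecture-HodgeConject-2755210d-0 2026-08-15T18:27:12Z · rev 8 · ledger route-HodgeConjecture-PeriodDeficiency
GENERATED by the gate from the ledger (D-0016/17). Provers cite these decls: `theorem foo : Summit.HodgeConjecture.HodgeConjecture.Theses.PeriodDeficiency.<Decl> := …` in Summits/HodgeConjecture/HodgeConjecture/Theorems/<Name>.lean.
-/

namespace Summit.HodgeConjecture.HodgeConjecture.Theses.PeriodDeficiency

open scoped BigOperators Topology Manifold Classical MeasureTheory ProbabilityTheory Matrix InnerProductSpace ComplexConjugate ContinuousMap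
open Filter Set Function TopologicalSpace MeasureTheory

attribute [summit_statement] _root_.HodgeConjecture

/-- item stmt-HodgeConjecture-11593 · crux · rank 2 · open · by planner
why it might fail: Typed UNconditionally (GPC_K is not a hypothesis of the decl): a new transcendence inequality δ_W(s) ≤ dim W. One transcendental atypical special point of zero period dimension (rank-2 attractor of a ℚ̄ CY3 pencil at a non-algebraic modulus) refutes it and GPC_K, itself open beyond 1-motives.
sources: BakkerTsimerman2025, Andre2004, Bertolin2002, Andre1996Motifs, BostCharles2014, Arapura2013
[crux] (card K1, sharpened; the GPC_K-conditional content of the bridge) for the classical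
Betti–Hodge datum B, every σ : ℚ̄ → ℂ, every smooth projective family f₀ : 𝒳₀ → S₀ over a smooth
irreducible quasi-compact ℚ̄-scheme, every degree i, geometric VHS datum D of Rⁱf_*ℚ and every s ∈
S(ℂ) with ℚ̄-Zariski closure W = ⋂{Z ⊇ {s} closed, Aut(ℂ/ℚ̄)-stable}: dim Ď_{G_W} ≤ dim
Ď_{MT(Hⁱ(X_s))} + dim W (genericPeriodDomainDim ≤ mtDomainDimAt + zariskiDimOnPoints; only pointwise
Hodge structures enter, pinned by B.IsClassical). Derivation from GPC_K in § Why this line; expected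
sharpening dim W ↦ period dimension of W via the BBT Stein factorisation and KOU Lemma 3.4.
[difficulty: open-problem] -/
@[route_item "route-HodgeConjecture-PeriodDeficiency"]
def DeficiencyBound : Prop :=
  open Literature.AlgebraicGeometry.Motives Literature.AlgebraicGeometry.HodgeTheory in ∀ (B : BettiHodgeData ℂ), B.IsClassical → ∀ [HodgeTensorFacts.{0, 0}] (σ : AlgebraicClosure ℚ →+* ℂ) ⦃𝒳₀ S₀ : SchemeOver (AlgebraicClosure ℚ)⦄ (f₀ : 𝒳₀ ⟶ S₀) (n i : ℕ) (D : GeometricVHSData B ((baseChangeHom σ).map f₀) n i) [∀ s, Module.Finite ℚ (D.V.fiber s)], IrreducibleSpace S₀.left → CompactSpace S₀.left → AlgebraicGeometry.Smooth S₀.hom → ∀ s : ComplexPoints ((baseChangeHom σ).obj S₀), D.genericPeriodDomainDim (⋂₀ {Z | IsDefinedOverQbar σ S₀ Z ∧ s ∈ Z}) ≤ D.mtDomainDimAt s + zariskiDimOnPoints ((baseChangeHom σ).obj S₀) (⋂₀ {Z | IsDefinedOverQbar σ S₀ Z ∧ s ∈ Z})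

/-- item stmt-HodgeConjecture-11594 · crux · rank 3 · open · by planner
why it might fail: Open: fields of definition of special POINTS are exactly what Voisin's criterion (2007 p.2 'does not say anything about … an isolated point') and KOU Cor 1.14 leave; known only via Hodge⇒absolute Hodge (GGK VIII.A.6) or Shimura-type families. A transcendental isolated Hodge point refutes it and HC.
sources: Voisin2007HodgeLoci, KlinglerOtwinowskaUrbanik2023, GreenGriffithsKerr2012, BaldiKlinglerUllmo2024, CattaniDeligneKaplan1995JAMS, CharlesSchnell2014Notes
[crux] (card headline, real carriers) for a smooth projective family f₀ : 𝒳₀ → S₀ over a smooth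
irreducible ℚ̄-scheme and a connected component C of the locus of Hodge classes of f = f₀ ⊗_σ ℂ in
degree 2p (HodgeLocus.lean: étalé topology of R²ᵖf_*ℂ, rational (p,p) fibre classes): if the
corresponding component of the Hodge locus is a single point, C.base = {s}, then {s} is defined over
ℚ̄, i.e. s ∈ S(ℚ̄). Corollary of HGQ (W := ℚ̄-closure of s would lie in C.base) and, in the atypical
regime, of DeficiencyBound + BKU Thm 2.3; = FiniteTreeOfFlavours.RigidImpliesQbar freed from
hypersurfaces; the case "Voisin's criterion does not say anything about" (Voisin2007HodgeLoci p. 2),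
KOU Cor. 1.14's residue, BKU §2.1 "zero period dimension". [deps: QbarGenericIsHodgeGeneric]
[difficulty: XL] -/
@[route_item "route-HodgeConjecture-PeriodDeficiency"]
def IsolatedHodgePointsQbar : Prop :=
  open Literature.AlgebraicGeometry.Motives Literature.AlgebraicGeometry.HodgeTheory in ∀ (σ : AlgebraicClosure ℚ →+* ℂ) ⦃𝒳₀ S₀ : SchemeOver (AlgebraicClosure ℚ)⦄ (f₀ : 𝒳₀ ⟶ S₀) (n : ℕ), IsSmoothProjectiveFamily ((baseChangeHom σ).map f₀) n → IrreducibleSpace S₀.left → AlgebraicGeometry.Smooth S₀.hom → ∀ (p : ℕ) (C : HodgeLocusComponent ((baseChangeHom σ).map f₀) n p) (s : ComplexPoints ((baseChangeHom σ).obj S₀)), C.base = {s} → IsDefinedOverQbar σ S₀ {s}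

/-- item stmt-HodgeConjecture-11595 · crux · rank 4 · open · by planner
why it might fail: = pointwise KOU Conj 1.5(a), geometric case: proved only for abelian/K3-type VHS (Deligne, André) and weakly non-factor positive period dimension (KOU Thm 1.12); special points and weakly-factor loci in level ≥ 2 stay open. False iff a Hodge-locus component of a ℚ̄-family is not over ℚ̄ (⇒ ¬HC).
sources: KlinglerOtwinowskaUrbanik2023, BaldiKlinglerUllmo2024, Voisin2007HodgeLoci, Andre1996Motifs, Deligne1982HodgeCycles, arXiv:1408.2488
[crux] (HGQ, first conjunct of X) for the classical Betti–Hodge datum, every smooth projective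
family f₀ : 𝒳₀ → S₀ over a smooth irreducible ℚ̄-scheme, every degree i, geometric VHS datum D and
every s ∈ S(ℂ): s is Hodge-generic (dim MT maximal, VHSData.IsHodgeGenericIn) in its ℚ̄-Zariski
closure W. Equivalent in the honest model to "every irreducible component of every (tensorial) Hodge
locus of a ℚ̄-family is defined over ℚ̄" (KOU Conj. 1.5(a), geometric case); HC ⇒ HGQ. Layer-2 plan:
DeficiencyBound + BKU Thm 2.3 settle zero period dimension in level ≥ 3; KOU Thm 1.12 settles weakly
non-factor positive period dimension; residues = level ≤ 2 typical points (CM/Kuga–Satake engines)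
and weakly-factor subvarieties. [deps: DeficiencyBound] [difficulty: open-problem] -/
@[route_item "route-HodgeConjecture-PeriodDeficiency", crux]
def QbarGenericIsHodgeGeneric : Prop :=
  open Literature.AlgebraicGeometry.Motives Literature.AlgebraicGeometry.HodgeTheory in ∀ (B : BettiHodgeData ℂ), B.IsClassical → ∀ [HodgeTensorFacts.{0, 0}] (σ : AlgebraicClosure ℚ →+* ℂ) ⦃𝒳₀ S₀ : SchemeOver (AlgebraicClosure ℚ)⦄ (f₀ : 𝒳₀ ⟶ S₀) (n i : ℕ) (D : GeometricVHSData B ((baseChangeHom σ).map f₀) n i) [∀ s, Module.Finite ℚ (D.V.fiber s)], IrreducibleSpace S₀.left → AlgebraicGeometry.Smooth S₀.hom → ∀ s : ComplexPoints ((baseChangeHom σ).obj S₀), D.IsHodgeGenericIn (⋂₀ {Z | IsDefinedOverQbar σ S₀ Z ∧ s ∈ Z}) s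

/-- item stmt-HodgeConjecture-11596 · crux · rank 5 · open · by planner
why it might fail: HC for ℚ̄-definable varieties is open in every dimension ≥ 4 exactly like HC (Weil-type classes on ℚ̄-abelian varieties beyond the known families; (p,p) classes on level ≥ 3 hypersurfaces over ℚ̄); transcendence of a modulus says nothing here; only absolute-Hodge/motivated engines bear on it.
sources: Deligne1982HodgeCycles, Andre1996Motifs, Voisin2007HodgeLoci, CharlesSchnell2014Notes, Deligne2000
[crux] (second conjunct of X) the Hodge conjecture (HodgeTheory.HodgeConjectureFor on the real
carriers) for every smooth projective complex variety of the form X₀ ×_{ℚ̄,σ} ℂ — verbatim the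
antecedent of PeriodsPolice.QbarDescent, the conclusion of PeriodsPolice's sub-assembly (GPC_And ∧
CompactCommutantTrivial ∧ LefschetzB ∧ ClassicalBridge), and the target of
QbarEnvelope.HCOverNumberFields / FiniteTreeOfFlavours.RigidQbarClassesAlgebraic; not attacked
inside this route. [difficulty: open-problem] -/
@[route_item "route-HodgeConjecture-PeriodDeficiency", crux]
def HodgeConjectureQbar : Prop :=
  open Literature.AlgebraicGeometry.Motives Literature.AlgebraicGeometry.HodgeTheory in ∀ (σ : AlgebraicClosure ℚ →+* ℂ) ⦃n : ℕ⦄ ⦃X₀ : SchemeOver (AlgebraicClosure ℚ)⦄, IsSmoothProjective n ((baseChangeHom σ).obj X₀) → HodgeConjectureFor n ((baseChangeHom σ).obj X₀)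

/-- item stmt-HodgeConjecture-11614 · crux (kind.auto-crux: conjecture-grade) · rank 6 · open · by planner
why it might fail: auto-crux — conjecture-grade statement (docstring avows it ('conjecture')); it is open, so it may simply be false
sources: conjecture-registry
[crux] THE CONDITIONAL INPUT (card K3; conjecture carried as a route item per the "conjectures live
in our theses" rule, informal until the definition request `AndrePeriodConjectureOver` lands):
André's generalized (André–Grothendieck) period conjecture over a finitely generated field K ⊂ ℂ —
for X₀ smooth projective over K (here K = ℚ̄(W) embedded by the point s, X₀ = the fibre X_s with its
K-structure), trdeg_ℚ K(entries of the comparison isomorphism H_dR(X₀^m/K) ⊗_K ℂ ≅ H_B(X₀^m(ℂ), ℚ) ⊗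
ℂ, all m) ≥ dim G_mot(h(X₀)) (Nori motivic Galois group over K; ≥ dim of André's motivated Galois
group of X₀ ⊗ ℂ by base change = closed immersion and Arapura2013). This is exactly what
DeficiencyBound consumes: GPCK ∧ AndreSandwich (G_W ⊆ G_And(X_s)⁰, provable from Andre1996Motifs
§2.5 Scolie + Thm 0.4) ∧ TorsorFlagCount (dim of the K̄-Zariski closure of the comparison point ≤
dim Ď_{MT(s)} + dim G_And − dim(G_And⁰·F_s), BostCharles2014 §2 + Deligne1982HodgeCycles Prop 3.4) ⟹
DeficiencyBound. Why it might fail: open beyond 1-motives (HuberWustholz2022; Chudnovsky for CM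
elliptic curves); implies Schanuel's conjecture (André); its functional analogue is a theorem
(BakkerTsimerman2025 Thm 1.1) b -/
@[route_item "route-HodgeConjecture-PeriodDeficiency"]
def GPCK : Prop :=
  ∀ (K : Type) [Field K] [CharZero K] (P : Literature.AlgebraicGeometry.Motives.PeriodRealization K), P.IsClassical → ∀ (σ : K →+* ℂ) (n : ℕ) (X₀ : Literature.AlgebraicGeometry.Motives.SchemeOver K), Literature.AlgebraicGeometry.Motives.IsSmoothProjective n X₀ → Literature.AlgebraicGeometry.Motives.PeriodRealization.AndrePeriodBound P σ n X₀

/-- item stmt-HodgeConjecture-15380 · crux · rank 7 · open · by planner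
why it might fail: TRUE on paper (Voisin 2007 Prop 0.7 proof; CS Thm 11.3.19; 3 reviews concur) — risk is formal: proved in tree only modulo 5 classical leaves, 3 with no decl (RET+ℚ̄-descent SGA1 XII 5.1/XIII 4.6, strong Hironaka/ℚ̄, Fulton 19.2(b) pull-back), 2 unproved named facts (Deligne GIC, polarizability).
sources: Voisin2007HodgeLoci, CharlesSchnell2014Notes, SGA1, DeligneHodgeII1971, Hironaka1964, Fulton1998
[crux] PROMOTED NAMED FACT (route-choice repair 2026-08-16, unit
rchoice-Summits-HodgeConjecture-HodgeC-7d45a5f9): Voisin's finite-monodromy step = verbatim the body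
of Literature.AlgebraicGeometry.HodgeTheory.voisin2007_algebraic_of_finite_monodromyOrbit_of_qbar
(with `IsQuasiProjectiveOver` unfolded so that it elaborates with the route's imports;
definitionally equal to the Literature constant, `Iff.rfl` and `fun h => h` checked), judged XL-apex
as a non-crux fact (three review-splits concur: faithful to Voisin 2007 §3, proof of Prop. 0.7 =
arXiv math/0605766 Prop. 1.7 p. 7, and Charles–Schnell Thm 11.3.19, and TRUE). Statement: for σ : ℚ̄
→+* ℂ, a ℚ̄-morphism f₀ : 𝒳₀ → S₀ of quasi-projective ℚ̄-schemes with S₀ smooth irreducible whose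
complexification f₀ ⊗_σ ℂ is a smooth projective family of relative dimension n, a point s ∈ S(ℂ)
and a rational (p,p) class α on the fibre 𝒳_s whose monodromy orbit {β | ∃ loop γ at s,
IsContinuationAlong γ α β} (flat continuations in the étalé space of R²ᵖf_*ℂ) is finite: IF every
rational (q,q) class on every smooth projective X₀ ⊗_σ ℂ (X₀ a ℚ̄-scheme) is algebraic THEN α ∈
algebraicClasses (𝒳_s) p. KNOWN MATHEMATICS, formally apex: PROVED in th -/
@[route_item "route-HodgeConjecture-PeriodDeficiency", crux]
def FiniteMonodromyAlgebraicOfQbar : Prop :=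
  open Literature.AlgebraicGeometry.Motives Literature.AlgebraicGeometry.HodgeTheory in ∀ (σ : AlgebraicClosure ℚ →+* ℂ) ⦃𝒳₀ S₀ : SchemeOver (AlgebraicClosure ℚ)⦄ (f₀ : 𝒳₀ ⟶ S₀) (n p : ℕ), (∃ (P : SchemeOver (AlgebraicClosure ℚ)) (j : 𝒳₀ ⟶ P), IsProjectiveOver P ∧ AlgebraicGeometry.IsOpenImmersion j.left) → (∃ (P : SchemeOver (AlgebraicClosure ℚ)) (j : S₀ ⟶ P), IsProjectiveOver P ∧ AlgebraicGeometry.IsOpenImmersion j.left) → IrreducibleSpace S₀.left → AlgebraicGeometry.Smooth S₀.hom → IsSmoothProjectiveFamily ((baseChangeHom σ).map f₀) n → ∀ (s : ComplexPoints ((baseChangeHom σ).obj S₀)) (α : complexBetti (fiberOver ((baseChangeHom σ).map f₀) s) (2 * p)), IsRationalClass α → IsOfHodgeType n (fiberOver ((baseChangeHom σ).map f₀) s) (2 * p) p p α → {β : complexBetti (fiberOver ((baseChangeHom σ).map f₀) s) (2 * p) | ∃ γ : Path s s, IsContinuationAlong γ α β}.Finite → (∀ ⦃m : ℕ⦄ ⦃X₀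 : SchemeOver (AlgebraicClosure ℚ)⦄, IsSmoothProjective m ((baseChangeHom σ).obj X₀) → ∀ (q : ℕ) (c : complexBetti ((baseChangeHom σ).obj X₀) (2 * q)), IsRationalClass c → IsOfHodgeType m ((baseChangeHom σ).obj X₀) (2 * q) q q c → c ∈ algebraicClasses ((baseChangeHom σ).obj X₀) q) → α ∈ algebraicClasses (fiberOver ((baseChangeHom σ).map f₀) s) p

/-- item stmt-HodgeConjecture-11597 · support · rank 9 · open · by planner
sources: VoisinHodgeI2002, VoisinHodgeII2003, DeligneHodgeII1971, Deligne2000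
[support] CONSTRUCTION / infrastructure debt (as PeriodsPolice.ClassicalBridge): there is a
classical Betti–Hodge datum B (BettiHodgeData.IsClassical: Hodge structures = Hodge decomposition of
X^an, cycle classes supported on cycles, fundamental-class data), Deligne's tensor-filtration facts
hold (HodgeTensorFacts), and every smooth projective family over a smooth irreducible ℚ̄-scheme
carries a geometric VHS datum for B in every degree (Ehresmann + proper base change: Rⁱf_*ℚ with its
fibrewise Hodge structures and a flat polarisation), with finite-dimensional fibres. Known
mathematics (Hodge decomposition, Deligne Hodge II 1.1–1.2, Voisin II §3.1), formally large.
[difficulty: XL] -/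
@[route_item "route-HodgeConjecture-PeriodDeficiency", crux]
def ClassicalGeometricVHS : Prop :=
  open Literature.AlgebraicGeometry.Motives in ∃ B : BettiHodgeData ℂ, B.IsClassical ∧ HodgeTensorFacts.{0, 0} ∧ ∀ (σ : AlgebraicClosure ℚ →+* ℂ) ⦃𝒳₀ S₀ : SchemeOver (AlgebraicClosure ℚ)⦄ (f₀ : 𝒳₀ ⟶ S₀) (n i : ℕ), IsSmoothProjectiveFamily ((baseChangeHom σ).map f₀) n → IrreducibleSpace S₀.left → AlgebraicGeometry.Smooth S₀.hom → ∃ D : GeometricVHSData B ((baseChangeHom σ).map f₀) n i, ∀ s, Module.Finite ℚ (D.V.fiber s)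

/-- item stmt-HodgeConjecture-11598 · support · rank 9 · open · by planner
sources: CharlesSchnell2014Notes, Voisin2007HodgeLoci, DeligneHodgeII1971, Andre1996Motifs, BakkerTsimerman2025
[support] KNOWN MATHEMATICS (the shape of CharlesSchnell2014Notes Thm 11.3.19 / Voisin2007HodgeLoci
Prop. 1.2 proof): ClassicalGeometricVHS → HGQ → HCQ̄ → HodgeModelsExist → HodgeConjecture. Proof:
given X/ℂ smooth projective and a rational (p,p) class α, spread X over its field of definition: X ≅
fibre at a ℚ̄-generic point s of f₀ ⊗ ℂ, f₀ smooth projective over a smooth irreducible affine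
ℚ̄-variety S₀ (so W = S); HGQ at s (degree 2p, only the pointwise Hodge structures of D are used,
pinned by IsClassical) gives dim MT(s) ≥ dim MT(t) for all t, hence MT(s) = G_S ⊇ H_S (André:
connected monodromy inside the generic MT group, Andre1996Motifs / BakkerTsimerman2025 Thm 2.6), so
a finite-index subgroup of π₁(S(ℂ), s) fixes α; by Riemann existence the finite étale cover S' → S
is defined over ℚ̄; Deligne's global invariant cycle theorem + semisimplicity (DeligneHodgeII1971
4.1.1) give a Hodge class β on a smooth projective compactification of 𝒳 ×_S S' (a ℚ̄-variety)
restricting to α; HCQ̄ makes β algebraic; restriction to the fibre and the iso X ≅ X_s preserve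
algebraic classes (Fulton §6, §19); the Hodge-model conjunct is HodgeModelsExist. [difficulty: XL] -/
@[route_item "route-HodgeConjecture-PeriodDeficiency", crux]
def GenericityReduction : Prop :=
  ClassicalGeometricVHS → QbarGenericIsHodgeGeneric → HodgeConjectureQbar → (∀ (n : ℕ) (X : Literature.AlgebraicGeometry.Motives.SchemeOver ℂ), Literature.AlgebraicGeometry.Motives.IsSmoothProjective n X → Nonempty (Literature.AlgebraicGeometry.HodgeTheory.HodgeModel n X)) → _root_.HodgeConjecture

/-- item stmt-HodgeConjecture-16363 · support · rank 9 · open · by planner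
sources: DeligneHodgeII1971, VoisinHodgeII2003, CharlesSchnell2014Notes, Deligne1968
[crux] PROMOTED NAMED FACT (route-choice repair 2026-08-16, harness-requested: the Literature fact
`HodgeTheory.deligne_globalInvariantCycles` was judged XL-apex — too large for one prover seat, and
non-crux facts are not split — after two discharge attempts bounced; it is load-bearing for crux
#3's only live line). Deligne's global invariant cycle theorem / théorème de la partie fixe (Hodge
II Thm 4.1.1; Voisin II Thm 4.24; Charles–Schnell Thm 11.3.4), hard inclusion, ℂ-coefficients,
pointwise, on the real carriers of HodgeLocus.lean: for a smooth projective family f : 𝒳 ⟶ S of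
relative dimension n over a smooth quasi-projective complex base (quasi-projectivity INLINED as ∃
open ℂ-immersion into a projective ℂ-scheme — Iff.rfl with HodgeTheory.IsQuasiProjectiveOver S — so
the route imports only HodgeLocus, never the fact file) and an open immersion i : 𝒳 ⟶ 𝒳̄ into a
smooth projective 𝒳̄, every continuous section σ of the étalé space FiberClass f k (a global =
monodromy-invariant section of Rᵏ f_* ℂ) takes at each s₀ the value of the restriction of some A ∈
Hᵏ(𝒳̄(ℂ); ℂ): σ s₀ = globalSection f k (i^* A) s₀. VERBATIM the body of the named fact (planner
SketchIff.lean: Iff.rfl, lean -/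
@[route_item "route-HodgeConjecture-PeriodDeficiency"]
def DeligneGlobalInvariantCycles : Prop :=
  ∀ (𝒳 Xbar S : Literature.AlgebraicGeometry.Motives.SchemeOver ℂ) (f : 𝒳 ⟶ S) (i : 𝒳 ⟶ Xbar) (n m : ℕ), Literature.AlgebraicGeometry.Motives.IsSmoothProjectiveFamily f n → (∃ (P : Literature.AlgebraicGeometry.Motives.SchemeOver ℂ) (j : S ⟶ P), Literature.AlgebraicGeometry.Motives.IsProjectiveOver P ∧ AlgebraicGeometry.IsOpenImmersion j.left) → AlgebraicGeometry.Smooth S.hom → Literature.AlgebraicGeometry.Motives.IsProjectiveOver Xbar → AlgebraicGeometry.SmoothOfRelativeDimension m Xbar.hom → AlgebraicGeometry.IsOpenImmersion i.left → ∀ (k : ℕ) (σ : Literature.AlgebraicGeometry.Motives.ComplexPoints S → Literature.AlgebraicGeometry.HodgeTheory.FiberClass f k), Continuous σ → (∀ s, (σ s).pt = s) → ∀ s₀ : Literature.AlgebraicGeometry.Motives.ComplexPoints S, ∃ A : Literature.AlgebraicGeometry.HodgeTheory.complexBetti Xbar k, σ s₀ = Literature.AlgebraicGeometry.HodgeTheory.globalSection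 f k (Literature.AlgebraicGeometry.HodgeTheory.complexBetti.map i k A) s₀

/-- item stmt-HodgeConjecture-2742 · support · rank 9 · closed · proved by Summit.HodgeConjecture.HodgeConjecture.Theorems.holomorphicDefect_hodgeModelsExist_proof @ 852a466105f7 (prover) · by planner
sources: SerreGAGA1956, VoisinHodgeI2002, Deligne2000
[support] = ∀ n X, Literature.AlgebraicGeometry.HodgeTheory.nonempty_hodgeModel n X (Serre GAGA §2 +
de Rham + the Hodge decomposition of the compact Kähler X^an); tree named fact, discharge in
progress (HodgeModelExistenceDischarge). [difficulty: L] -/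
@[route_item "route-HodgeConjecture-PeriodDeficiency", crux]
def HodgeModelsExist : Prop :=
  ∀ (n : ℕ) (X : Literature.AlgebraicGeometry.Motives.SchemeOver ℂ), Literature.AlgebraicGeometry.Motives.IsSmoothProjective n X → Nonempty (Literature.AlgebraicGeometry.HodgeTheory.HodgeModel n X)

/-- `HodgeModelsExist` holds: proved by `Summit.HodgeConjecture.HodgeConjecture.Theorems.holomorphicDefect_hodgeModelsExist_proof` @ 852a466105f7. -/
theorem HodgeModelsExist_holds : HodgeModelsExist := _root_.Summit.HodgeConjecture.HodgeConjecture.Theorems.holomorphicDefect_hodgeModelsExist_proof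

-- earlier Assembly (stmt-HodgeConjecture-11599, replaced 2026-08-15T21:16:24Z -> stmt-HodgeConjecture-13787): retired by None — QbarGenericIsHodgeGeneric → HodgeConjectureQbar → ClassicalGeometricVHS → GenericityReduction → HodgeModelsExist → _root_.HodgeConjecture
/-- item stmt-HodgeConjecture-13787 · assembly · rank 1 · open · by planner
sources: Voisin2007HodgeLoci, CharlesSchnell2014Notes
[assembly] X → Statement ("HGQ ∧ HC(ℚ̄) suffice"): QbarGenericIsHodgeGeneric → HodgeConjectureQbar →
HodgeConjecture — the thesis implication proper (D-0014 (d) frame statement #1). Known mathematics,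
formally XL: it is the composition of the three support items ClassicalGeometricVHS,
GenericityReduction, HodgeModelsExist (spread X over ℚ̄; HGQ at the ℚ̄-generic modulus s gives MT(s)
= G_S ⊇ connected monodromy; finite étale cover defined over ℚ̄; Deligne's global invariant cycle
theorem + semisimplicity lift the class to a Hodge class on a smooth projective ℚ̄-model of the
total space; HC(ℚ̄); restrict to the fibre — CharlesSchnell2014Notes Thm 11.3.19 /
Voisin2007HodgeLoci Prop. 1.2 shape), `fun hC hG hM h₁ h₂ => hG hC h₁ h₂ hM` once those land.
Restated 2026-08-15 (route-repair, ground-failed) from the rev-5 chain `HGQ → HCQ̄ →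
ClassicalGeometricVHS → GenericityReduction → HodgeModelsExist → HodgeConjecture`, which the ground
battery closes by `intros; aesop` because GenericityReduction is literally that chain
(ground.trivial = pure bookkeeping). The deciding theorem `closes` (hypotheses HGQ, HCQ̄,
ClassicalGeometricVHS, GenericityReduction, HodgeModelsExist) is unchanged and do -/
@[route_item "route-HodgeConjecture-PeriodDeficiency"]
def Assembly : Prop :=
  QbarGenericIsHodgeGeneric → HodgeConjectureQbar → _root_.HodgeConjecture

/-! D-0027 §2.1 — DECIDING THEOREM (planner-authored via `route open/edit --closes-file`; by planner-rrepair-HodgeConjecture-PeriodDeficien-77b0e187-0 2026-08-15T19:09:26Z):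
its hypotheses are this route's items and its conclusion the sub-problem Statement (glue_lint), and it elaborates with this file. -/

-- D-0027 §2.1 deciding theorem of route PeriodDeficiency — UNCHANGED text, re-supplied 2026-08-15 (attempt 3) by the
-- cone route-repair seat only to obtain a fresh native verdict + #h21_route_deps evaluation after the rev-2
-- import repair (8 HodgeTensor `_holds` proof files added, GeometricVHSPolarizedTransport dropped).
@[closes "route-HodgeConjecture-PeriodDeficiency"] theorem closes (h₁ : QbarGenericIsHodgeGeneric) (h₂ : HodgeConjectureQbar)
    (h₃ : ClassicalGeometricVHS) (h₄ : GenericityReduction) (h₅ : HodgeModelsExist) :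
    _root_.HodgeConjecture :=
  h₄ h₃ h₁ h₂ h₅

end Summit.HodgeConjecture.HodgeConjecture.Theses.PeriodDeficiency
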